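import Summits.HodgeConjecture.HodgeConjecture.Theorems.F0P2cStubCEOfLocalThetaTypes
import HarnessLib

/-!
# Crux `H413`, (C) desk — THE ACYCLIC FOLD VEHICLE FOR THE ENGINE LETTER CE: the rung-2 road `PK + GL + LW + LR + LTpu ⟹ CE` AT THEOREMS LEVEL
# (Lines-free twin of §4 of `Cruxes/H413/Lines/F0_P2CELocalToGlobal.lean` v1; F0P2-plan (g4) ruling 2026-08-31T03:44:37Z (3), ref1 O50-1 ∕ r53 (3)(i))

Cell hodgecm-mathlib (D-0151), FLOOR 0, crux item H413 = stmt-HodgeConjecture-24833; programme P2 (socket item F0HdictE = stmt-HodgeConjecture-27455, skeleton =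
the (C)-line `Cruxes/H413/Lines/F0_P2CohFinComponentIsThetaC.lean`).  Author F0P2-p01 (g3).  THEOREMS ONLY (no `def`, no instance, no named fact, no
`sorry`); `--supports stmt-HodgeConjecture-24833 --as helper`; imports NO `Cruxes/…/Lines` module (s380b): the five stub bodies of the rung-2 sub-line
`F0_P2CELocalToGlobal` v1 (tree sha16 6bf3d7538ed7ccfd) — PK :217, GL :268, LW :279, LR :348, LTpu :387 — are RESTATED VERBATIM as hypotheses, and the
conclusion is the REGISTERED engine letter CE of the (C)-line (`StubCELocalTypesTheta`, v1.2R :217–251 = the sub-line's `CETarget` :115) with `IsLocalTypeAt`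
UNFOLDED, exactly as in ★ p805164 `F0P2cStubCEOfLocalThetaTypes.stubCE_of_localThetaTypes`.  HC_CM is proved only modulo the printed citations until rung 0
closes; this file proves no printed citation (PK is the engine letter; GL ∕ LW ∕ LR ∕ LTpu are in-house rows of F0P2-p03 (g3), F0P2-p02 (g2), F0P2-p04 (g3)).

WHY (ref1 O50-1): the sub-line proves CE from its stubs but cannot be imported by the (C)-line that must FOLD `stub_CE_localTypesTheta` (Lines ↔ Lines);
this Theorems file is the acyclic vehicle — the registrar's «CE FOLD» edition of the (C)-line declares `def StubPKLocalThetaClasses` (v1 :217–266 verbatim) +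
`theorem stub_PK_localThetaClasses … := by sorry` and closes
`theorem stub_CE_localTypesTheta : StubCELocalTypesTheta := F0P2eCEOfRung2.stubCE_of_PK_GL_LW_LR_LTpu stub_PK_localThetaClasses ‹GL★› ‹LW★› ‹LR★› ‹LTpu★›`
⇒ registered stubs on 27455 go [CE, CF, CI, E3] → [PK, E3] in ONE skeleton (F0P2-plan (g4) ruling (4)(β)).

THE ROAD (F0P2-plan (g4), PLAN-P2 v4∕v4.1): PK (ENGINE, place-by-place: `σ_v` is `X_v(μ, ε_v, χ) ∘ κ_v⁻¹`-isotypic for local classes `ε_v`, cofinitely `[a₀]`)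
[Rogawski1990 Thm 13.3.6 (c), 13.1.1; GelbartRogawski1991 Thm 5.1.1, Lem 5.1.2; HarrisKudlaSweet1996 Thm 6.1] + GL (Hasse for norm classes: a GLOBAL `a` with
the class of `ε_v` everywhere) [Omeara1963 §71 Thm 71:19] + LW (local norm witness) + LR (local re-enumeration `e ↦ e'` of Liu's type) + LTpu (local type
transport at `Equiv.prodUnique`) [MoeglinVignerasWaldspurger1987 Chap. 3; Liu2021 Lem D.1 (3)] ⟹ CE_R (the local components of `σ` ARE `X_v(μ,a,χ) ∘ κ_v⁻¹`)
⟹ CE (★ p805164 over ★ CE-L p803803).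

* `isotypicComponent_comp_congr_of_equiv` — isotypy is blind to the type's isomorphism class, pulled back along any `φ` (= the sub-line's §4 lemma);
* **`stubCE_of_PK_GL_LW_LR_LTpu (hPK) (hGL) (hLW) (hLR) (hLTpu) : ‹registered CE body›`** — proof = the sub-line's `lt_of_LR_LTpu` ∘ `coreCER_of_PK_GL_LW_LT` ∘
  ★ `stubCE_of_localThetaTypes`, with CE_R never restated (it is the sequel's binder, filled by `refine`).

## References
* [Rogawski1990] Thm 13.3.6 (c), Thm 13.1.1, §12.2–12.3, §13.3.  [Rogawski1992] Thm 1.1.  [GelbartRogawski1991] Thm 5.1.1, Lem 5.1.2.  [HarrisKudlaSweet1996] Thm 6.1.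
* [Liu2021] Def 4.11, Def 4.12, Rem 4.14, App. D Lem D.1 (1)(3), Thm 4.18 (2).  [Omeara1963] §63, §65 Prop 65:21, §71 Thm 71:19.  [Kudla1994] §3 Thm 3.1.
* [MoeglinVignerasWaldspurger1987] Chap. 2 II.1, Chap. 3 I.1–I.3, IV.4.  [Flath1979] Thm 3.  [Bump1997] §3.4 Prop 3.4.1.
-/

set_option autoImplicit false

-- the mandated namespace has the single-problem summit's repeated segment (`HodgeConjecture.HodgeConjecture`)
set_option linter.dupNamespace false

noncomputable section

open NumberField MeasureTheory IsDedekindDomain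
open scoped Matrix ComplexOrder

namespace Summit.HodgeConjecture.HodgeConjecture.Cruxes.H413.F0P2eCEOfRung2

open Literature.NumberTheory Literature.NumberTheory.Automorphic Literature.NumberTheory.Automorphic.UnitaryGroup
open Literature.NumberTheory.Automorphic.UnitaryGroup.CotangentForms
open Literature.NumberTheory.Automorphic.IdeleClassGroup
open Literature.NumberTheory.Automorphic.Liu2021 Literature.NumberTheory.Automorphic.Liu2021.Def411WeilCarriers
open Literature.NumberTheory.Automorphic.Liu2021.Def411WeilCarriersDoubling
open Literature.NumberTheory.GelbartRogawski1991 Literature.NumberTheory.GelbartRogawski1991.UnitaryDualPair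
open Literature.NumberTheory.GelbartRogawski1991.UnitaryDualPair.WeilCoinv
open Literature.RepresentationTheory Literature.RepresentationTheory.Liu2021
open Literature.NumberTheory.Rogawski1990
open Summit.HodgeConjecture.CorCM.Transposition

/-- **isotypy does not see the type within its isomorphism class — pulled back along any homomorphism** (= the sub-line's §4 lemma, restated here so
that no `Lines` module is imported): for `E : ρ ≃ ρ'` and `φ : G' →* G`, the `ρ ∘ φ`- and `ρ' ∘ φ`-isotypic components of every `ℂ[G']`-module agree
(★ `isotypicComponent_asModule_congr_type`). [cite: Bump1997, §3.4 Prop 3.4.1] -/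
theorem isotypicComponent_comp_congr_of_equiv {G G' V V' W' : Type*} [Group G] [Group G'] [AddCommGroup V] [Module ℂ V]
    [AddCommGroup V'] [Module ℂ V'] [AddCommGroup W'] [Module ℂ W'] {ρ : Representation ℂ G V} {ρ' : Representation ℂ G V'}
    (E : Representation.Equiv ρ ρ') (π : Representation ℂ G' W') (φ : G' →* G) :
    isotypicComponent (MonoidAlgebra ℂ G') (Representation.asModule π) (Representation.asModule (ρ.comp φ)) =
      isotypicComponent (MonoidAlgebra ℂ G') (Representation.asModule π) (Representation.asModule (ρ'.comp φ)) :=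
  Literature.RepresentationTheory.isotypicComponent_asModule_congr_type π (ρ.comp φ) (ρ'.comp φ) E.toLinearEquiv fun g w => by
    change E.toIntertwiningMap (ρ (φ g) w) = ρ' (φ g) (E.toIntertwiningMap w)
    exact Representation.IntertwiningMap.isIntertwining _ _ E.toIntertwiningMap (φ g) w

set_option synthInstance.maxHeartbeats 400000 in
set_option maxHeartbeats 8000000 in
/-- **THE REGISTERED ENGINE LETTER CE FROM THE RUNG-2 ROAD `PK + GL + LW + LR + LTpu`** (bodies = sub-line v1 :217 ∕ :268 ∕ :279 ∕ :348 ∕ :387 VERBATIM;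
conclusion = (C)-line `StubCELocalTypesTheta` with `IsLocalTypeAt` unfolded).  PK gives `(μ, χ, (ε_v)_v, a₀)` with `σ ∘ inclPlace v` `X_v(μ,ε_v,χ) ∘ κ_v⁻¹`-isotypic;
GL a GLOBAL `a` in the class of `ε_v` at every `v`; LW the norm witness; `LR ∘ LTpu ∘ LR` the equivalence `X_v(μ,ε_v,χ)[e₁] ≃ X_v(μ,a,χ)[e₁]` through `prodUnique`;
isotypy is carried along it (`isotypicComponent_comp_congr_of_equiv`) — this is CE_R, and ★ `F0P2cStubCEOfLocalThetaTypes.stubCE_of_localThetaTypes` turns CE_R into CE.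
[cite: Rogawski1990, Thm 13.3.6 (c)] [cite: GelbartRogawski1991, Thm 5.1.1, Lem 5.1.2] [cite: Liu2021, Def 4.11, Def 4.12, App. D Lem D.1 (1)(3)]
[cite: Omeara1963, §71 Thm. 71:19] [cite: MoeglinVignerasWaldspurger1987, Chap. 3 IV.4] -/
theorem stubCE_of_PK_GL_LW_LR_LTpu
    (hPK :
      ∀ (L : Type) [Field L] [NumberField L] [IsCMField L] (ι : L →+* ℂ) (H : Matrix (Fin 3) (Fin 3) L) (T : GL (Fin 3) ℂ)
        (hT : (T : Matrix (Fin 3) (Fin 3) ℂ)ᴴ * H.map ι * (T : Matrix (Fin 3) (Fin 3) ℂ) = Literature.Geometry.ComplexHyperbolic.BallModel.J),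
        (∀ τ' : L →+* ℂ, InfinitePlace.mk τ' ≠ InfinitePlace.mk ι → (H.map τ').PosDef) → 2 ≤ Module.finrank ℚ ↥(maximalRealSubfield L) →
        ∀ {n' : ℕ} (e₁ : Fin 3 × Fin 1 ≃ Fin n') (dV : Fin 3 → L) (hdV : ∀ i, IsCMField.complexConj L (dV i) = dV i)
          (hdV0 : ∀ i, dV i ≠ 0) (g : GL (Fin 3) L)
          (hg : ((g : Matrix (Fin 3) (Fin 3) L).map (cmConjRingHom L))ᵀ * H * (g : Matrix (Fin 3) (Fin 3) L) = Matrix.diagonal dV)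
          (ιV : finAdelic (↥(maximalRealSubfield L)) L (IsCMField.complexConj L) 3 H →*
              finAdelic (↥(maximalRealSubfield L)) L (IsCMField.complexConj L) 3 (Matrix.diagonal dV)),
            (∀ k, ((ιV k : finAdelic (↥(maximalRealSubfield L)) L (IsCMField.complexConj L) 3 (Matrix.diagonal dV)) :
                GL (Fin 3) (FiniteAdeleRing (𝓞 L) L)) =
              (toFinAdeleGL L 3 g)⁻¹ * (k : GL (Fin 3) (FiniteAdeleRing (𝓞 L) L)) * toFinAdeleGL L 3 g) →
            ∀ (μ : Measure (adelicGroupData (↥(maximalRealSubfield L)) L (IsCMField.complexConj L) 3 H).automorphicQuotient)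
              [(adelicGroupData (↥(maximalRealSubfield L)) L (IsCMField.complexConj L) 3 H).IsAutomorphicMeasure μ]
              (W : Type) [AddCommGroup W] [Module ℂ W]
              (σ : Representation ℂ (finAdelic (↥(maximalRealSubfield L)) L (IsCMField.complexConj L) 3 H) W),
              σ.IsIrreducible → σ.IsSmooth → σ.IsAdmissible →
              ∀ P : DiscreteAutomorphicRep (adelicGroupData (↥(maximalRealSubfield L)) L (IsCMField.complexConj L) 3 H) μ,
                (P.IsHolCotangentAt (cmArchSection L ι H T hT) (cmCompactFactor L ι H T hT) ∨
                  P.IsAntiholCotangentAt (cmArchSection L ι H T hT) (cmCompactFactor L ι H T hT)) →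
                P.HasFinComponent σ →
                ∃ (μ : Literature.NumberTheory.Automorphic.IdeleClassGroup L →ₜ* Circle) (hμ : IsConjugateSymplectic L μ), HasWeight L μ 1 ∧
                  ∃ (χ : Chi (↥(maximalRealSubfield L)) L (IsCMField.complexConj L))
                    (ε : HeightOneSpectrum (𝓞 ↥(maximalRealSubfield L)) → (↥(maximalRealSubfield L))ˣ) (a₀ : (↥(maximalRealSubfield L))ˣ),
                    (∀ᶠ v in Filter.cofinite, locF (↥(maximalRealSubfield L)) (imagUnitSq L) (ε v) v = locF (↥(maximalRealSubfield L)) (imagUnitSq L) a₀ v) ∧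
                      ∀ (v : HeightOneSpectrum (𝓞 ↥(maximalRealSubfield L))),
                        isotypicComponent (MonoidAlgebra ℂ (localPi L (IsCMField.complexConj L) 3 H v))
                          (Representation.asModule (σ.comp (inclPlace (↥(maximalRealSubfield L)) L (IsCMField.complexConj L) 3 H v)))
                          (Representation.asModule
                            (((show Representation ℂ (localPi L (IsCMField.complexConj L) 3 (Matrix.diagonal dV) v) _ from
                              (TwistedCoinv.rep (localCharOfCenter (↥(maximalRealSubfield L)) L (IsCMField.complexConj L)
                                  (JW (↥(maximalRealSubfield L)) L (ε v)) (JW_apply_ne_zero (↥(maximalRealSubfield L)) L (ε v)) χ.1 v)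
                                ((OmegaChiSplitting.chiLocalSplittingsD ⟨L⟩ e₁ dV hdV hdV0 (toHeckeCharacter L μ)
                                  ((isOscillatorChar_toHeckeCharacter_iff μ).mpr hμ) (ε v)).omegaLoc v)
                                (commute_omegaLoc_localCenter (↥(maximalRealSubfield L)) L (IsCMField.complexConj L) 3 e₁ (Matrix.diagonal dV)
                                  (JW (↥(maximalRealSubfield L)) L (ε v)) (complexConj_imagUnit L) (imagUnit_ne_zero L) (imagUnit_mul_self L)
                                  (realDiagonal_isSymm L dV hdV) (isSymm_TW (↥(maximalRealSubfield L)) (ε v)) (realDiagonal_map L dV hdV).symm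
                                  (JW_eq (↥(maximalRealSubfield L)) L (ε v)) (JW_apply_ne_zero (↥(maximalRealSubfield L)) L (ε v))
                                  (OmegaChiSplitting.chiLocalSplittingsD ⟨L⟩ e₁ dV hdV hdV0 (toHeckeCharacter L μ)
                                    ((isOscillatorChar_toHeckeCharacter_iff μ).mpr hμ) (ε v)) v)).comp
                                (UnitaryGroup.localLineInl L (IsCMField.complexConj L) 3 e₁ (Matrix.diagonal dV) (JW (↥(maximalRealSubfield L)) L (ε v)) v)) :
                                localPi L (IsCMField.complexConj L) 3 (Matrix.diagonal dV) v →* _).comp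
                              (localCongr L (IsCMField.complexConj L) g one_ne_zero
                                (F0P2cOmegaLocalType.formCongr_frame L H dV g hg) v).symm.toMulEquiv.toMonoidHom)) = ⊤)
    (hGL :
      ∀ (L : Type) [Field L] [NumberField L] [IsCMField L]
        (ε : HeightOneSpectrum (𝓞 ↥(maximalRealSubfield L)) → (↥(maximalRealSubfield L))ˣ) (a₀ : (↥(maximalRealSubfield L))ˣ),
        (∀ᶠ v in Filter.cofinite, locF (↥(maximalRealSubfield L)) (imagUnitSq L) (ε v) v = locF (↥(maximalRealSubfield L)) (imagUnitSq L) a₀ v) →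
          ∃ a : (↥(maximalRealSubfield L))ˣ, ∀ v : HeightOneSpectrum (𝓞 ↥(maximalRealSubfield L)), locF (↥(maximalRealSubfield L)) (imagUnitSq L) a v = locF (↥(maximalRealSubfield L)) (imagUnitSq L) (ε v) v)
    (hLW :
      ∀ (L : Type) [Field L] [NumberField L] [IsCMField L] (a₁ a₂ : (↥(maximalRealSubfield L))ˣ)
        (v : HeightOneSpectrum (𝓞 ↥(maximalRealSubfield L))),
        locF (↥(maximalRealSubfield L)) (imagUnitSq L) a₁ v = locF (↥(maximalRealSubfield L)) (imagUnitSq L) a₂ v →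
          ∃ x : (LocalRing L v)ˣ,
            algebraMap L (LocalRing L v) (algebraMap (↥(maximalRealSubfield L)) L (↑a₂⁻¹ : ↥(maximalRealSubfield L)) * imagUnit L) =
            (x : LocalRing L v) * conjLocal L (IsCMField.complexConj L) v x *
              algebraMap L (LocalRing L v) (algebraMap (↥(maximalRealSubfield L)) L (↑a₁⁻¹ : ↥(maximalRealSubfield L)) * imagUnit L))
    (hLR :
      ∀ (L : Type) [Field L] [NumberField L] [IsCMField L] {n n' : ℕ} (e : Fin 3 × Fin 1 ≃ Fin n) (e' : Fin 3 × Fin 1 ≃ Fin n')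
        (dV : Fin 3 → L) (hdV : ∀ i, IsCMField.complexConj L (dV i) = dV i) (hdV0 : ∀ i, dV i ≠ 0)
        (μ : Literature.NumberTheory.Automorphic.IdeleClassGroup L →ₜ* Circle) (hμ : IsConjugateSymplectic L μ)
        (a : (↥(maximalRealSubfield L))ˣ) (χ : Chi (↥(maximalRealSubfield L)) L (IsCMField.complexConj L))
        (v : HeightOneSpectrum (𝓞 ↥(maximalRealSubfield L))),
        Nonempty (Representation.Equiv
          (show Representation ℂ (localPi L (IsCMField.complexConj L) 3 (Matrix.diagonal dV) v) _ from
            (TwistedCoinv.rep (localCharOfCenter (↥(maximalRealSubfield L)) L (IsCMField.complexConj L)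
                (JW (↥(maximalRealSubfield L)) L a) (JW_apply_ne_zero (↥(maximalRealSubfield L)) L a) χ.1 v)
              ((OmegaChiSplitting.chiLocalSplittingsD ⟨L⟩ e dV hdV hdV0 (toHeckeCharacter L μ)
                ((isOscillatorChar_toHeckeCharacter_iff μ).mpr hμ) a).omegaLoc v)
              (commute_omegaLoc_localCenter (↥(maximalRealSubfield L)) L (IsCMField.complexConj L) 3 e (Matrix.diagonal dV)
                (JW (↥(maximalRealSubfield L)) L a) (complexConj_imagUnit L) (imagUnit_ne_zero L) (imagUnit_mul_self L)
                (realDiagonal_isSymm L dV hdV) (isSymm_TW (↥(maximalRealSubfield L)) a) (realDiagonal_map L dV hdV).symm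
                (JW_eq (↥(maximalRealSubfield L)) L a) (JW_apply_ne_zero (↥(maximalRealSubfield L)) L a)
                (OmegaChiSplitting.chiLocalSplittingsD ⟨L⟩ e dV hdV hdV0 (toHeckeCharacter L μ)
                  ((isOscillatorChar_toHeckeCharacter_iff μ).mpr hμ) a) v)).comp
              (UnitaryGroup.localLineInl L (IsCMField.complexConj L) 3 e (Matrix.diagonal dV) (JW (↥(maximalRealSubfield L)) L a) v))
          (show Representation ℂ (localPi L (IsCMField.complexConj L) 3 (Matrix.diagonal dV) v) _ from
            (TwistedCoinv.rep (localCharOfCenter (↥(maximalRealSubfield L)) L (IsCMField.complexConj L)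
                (JW (↥(maximalRealSubfield L)) L a) (JW_apply_ne_zero (↥(maximalRealSubfield L)) L a) χ.1 v)
              ((OmegaChiSplitting.chiLocalSplittingsD ⟨L⟩ e' dV hdV hdV0 (toHeckeCharacter L μ)
                ((isOscillatorChar_toHeckeCharacter_iff μ).mpr hμ) a).omegaLoc v)
              (commute_omegaLoc_localCenter (↥(maximalRealSubfield L)) L (IsCMField.complexConj L) 3 e' (Matrix.diagonal dV)
                (JW (↥(maximalRealSubfield L)) L a) (complexConj_imagUnit L) (imagUnit_ne_zero L) (imagUnit_mul_self L)
                (realDiagonal_isSymm L dV hdV) (isSymm_TW (↥(maximalRealSubfield L)) a) (realDiagonal_map L dV hdV).symm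
                (JW_eq (↥(maximalRealSubfield L)) L a) (JW_apply_ne_zero (↥(maximalRealSubfield L)) L a)
                (OmegaChiSplitting.chiLocalSplittingsD ⟨L⟩ e' dV hdV hdV0 (toHeckeCharacter L μ)
                  ((isOscillatorChar_toHeckeCharacter_iff μ).mpr hμ) a) v)).comp
              (UnitaryGroup.localLineInl L (IsCMField.complexConj L) 3 e' (Matrix.diagonal dV) (JW (↥(maximalRealSubfield L)) L a) v))))
    (hLTpu :
      ∀ (L : Type) [Field L] [NumberField L] [IsCMField L] (dV : Fin 3 → L)
        (hdV : ∀ i, IsCMField.complexConj L (dV i) = dV i) (hdV0 : ∀ i, dV i ≠ 0)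
        (μ : Literature.NumberTheory.Automorphic.IdeleClassGroup L →ₜ* Circle) (hμ : IsConjugateSymplectic L μ)
        (a₁ a₂ : (↥(maximalRealSubfield L))ˣ) (χ : Chi (↥(maximalRealSubfield L)) L (IsCMField.complexConj L))
        (v : HeightOneSpectrum (𝓞 ↥(maximalRealSubfield L))) (x : (LocalRing L v)ˣ),
        algebraMap L (LocalRing L v) (algebraMap (↥(maximalRealSubfield L)) L (↑a₂⁻¹ : ↥(maximalRealSubfield L)) * imagUnit L) =
            (x : LocalRing L v) * conjLocal L (IsCMField.complexConj L) v x *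
              algebraMap L (LocalRing L v) (algebraMap (↥(maximalRealSubfield L)) L (↑a₁⁻¹ : ↥(maximalRealSubfield L)) * imagUnit L) →
          Nonempty (Representation.Equiv
            (show Representation ℂ (localPi L (IsCMField.complexConj L) 3 (Matrix.diagonal dV) v) _ from
              (TwistedCoinv.rep (localCharOfCenter (↥(maximalRealSubfield L)) L (IsCMField.complexConj L)
                  (JW (↥(maximalRealSubfield L)) L a₁) (JW_apply_ne_zero (↥(maximalRealSubfield L)) L a₁) χ.1 v)
                ((OmegaChiSplitting.chiLocalSplittingsD ⟨L⟩ (Equiv.prodUnique (Fin 3) (Fin 1)) dV hdV hdV0 (toHeckeCharacter L μ)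
                  ((isOscillatorChar_toHeckeCharacter_iff μ).mpr hμ) a₁).omegaLoc v)
                (commute_omegaLoc_localCenter (↥(maximalRealSubfield L)) L (IsCMField.complexConj L) 3 (Equiv.prodUnique (Fin 3) (Fin 1)) (Matrix.diagonal dV)
                  (JW (↥(maximalRealSubfield L)) L a₁) (complexConj_imagUnit L) (imagUnit_ne_zero L) (imagUnit_mul_self L)
                  (realDiagonal_isSymm L dV hdV) (isSymm_TW (↥(maximalRealSubfield L)) a₁) (realDiagonal_map L dV hdV).symm
                  (JW_eq (↥(maximalRealSubfield L)) L a₁) (JW_apply_ne_zero (↥(maximalRealSubfield L)) L a₁)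
                  (OmegaChiSplitting.chiLocalSplittingsD ⟨L⟩ (Equiv.prodUnique (Fin 3) (Fin 1)) dV hdV hdV0 (toHeckeCharacter L μ)
                    ((isOscillatorChar_toHeckeCharacter_iff μ).mpr hμ) a₁) v)).comp
                (UnitaryGroup.localLineInl L (IsCMField.complexConj L) 3 (Equiv.prodUnique (Fin 3) (Fin 1)) (Matrix.diagonal dV) (JW (↥(maximalRealSubfield L)) L a₁) v))
            (show Representation ℂ (localPi L (IsCMField.complexConj L) 3 (Matrix.diagonal dV) v) _ from
              (TwistedCoinv.rep (localCharOfCenter (↥(maximalRealSubfield L)) L (IsCMField.complexConj L)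
                  (JW (↥(maximalRealSubfield L)) L a₂) (JW_apply_ne_zero (↥(maximalRealSubfield L)) L a₂) χ.1 v)
                ((OmegaChiSplitting.chiLocalSplittingsD ⟨L⟩ (Equiv.prodUnique (Fin 3) (Fin 1)) dV hdV hdV0 (toHeckeCharacter L μ)
                  ((isOscillatorChar_toHeckeCharacter_iff μ).mpr hμ) a₂).omegaLoc v)
                (commute_omegaLoc_localCenter (↥(maximalRealSubfield L)) L (IsCMField.complexConj L) 3 (Equiv.prodUnique (Fin 3) (Fin 1)) (Matrix.diagonal dV)
                  (JW (↥(maximalRealSubfield L)) L a₂) (complexConj_imagUnit L) (imagUnit_ne_zero L) (imagUnit_mul_self L)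
                  (realDiagonal_isSymm L dV hdV) (isSymm_TW (↥(maximalRealSubfield L)) a₂) (realDiagonal_map L dV hdV).symm
                  (JW_eq (↥(maximalRealSubfield L)) L a₂) (JW_apply_ne_zero (↥(maximalRealSubfield L)) L a₂)
                  (OmegaChiSplitting.chiLocalSplittingsD ⟨L⟩ (Equiv.prodUnique (Fin 3) (Fin 1)) dV hdV hdV0 (toHeckeCharacter L μ)
                    ((isOscillatorChar_toHeckeCharacter_iff μ).mpr hμ) a₂) v)).comp
                (UnitaryGroup.localLineInl L (IsCMField.complexConj L) 3 (Equiv.prodUnique (Fin 3) (Fin 1)) (Matrix.diagonal dV) (JW (↥(maximalRealSubfield L)) L a₂) v)))) :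
      ∀ (L : Type) [Field L] [NumberField L] [IsCMField L] (ι : L →+* ℂ) (H : Matrix (Fin 3) (Fin 3) L) (T : GL (Fin 3) ℂ)
        (hT : (T : Matrix (Fin 3) (Fin 3) ℂ)ᴴ * H.map ι * (T : Matrix (Fin 3) (Fin 3) ℂ) = Literature.Geometry.ComplexHyperbolic.BallModel.J),
        (∀ τ' : L →+* ℂ, InfinitePlace.mk τ' ≠ InfinitePlace.mk ι → (H.map τ').PosDef) → 2 ≤ Module.finrank ℚ ↥(maximalRealSubfield L) →
        ∀ {n' : ℕ} (e₁ : Fin 3 × Fin 1 ≃ Fin n') (dV : Fin 3 → L) (hdV : ∀ i, IsCMField.complexConj L (dV i) = dV i)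
          (hdV0 : ∀ i, dV i ≠ 0) (g : GL (Fin 3) L),
          ((g : Matrix (Fin 3) (Fin 3) L).map (cmConjRingHom L))ᵀ * H * (g : Matrix (Fin 3) (Fin 3) L) = Matrix.diagonal dV →
          ∀ (ιV : finAdelic (↥(maximalRealSubfield L)) L (IsCMField.complexConj L) 3 H →*
              finAdelic (↥(maximalRealSubfield L)) L (IsCMField.complexConj L) 3 (Matrix.diagonal dV)),
            (∀ k, ((ιV k : finAdelic (↥(maximalRealSubfield L)) L (IsCMField.complexConj L) 3 (Matrix.diagonal dV)) :
                GL (Fin 3) (FiniteAdeleRing (𝓞 L) L)) =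
              (toFinAdeleGL L 3 g)⁻¹ * (k : GL (Fin 3) (FiniteAdeleRing (𝓞 L) L)) * toFinAdeleGL L 3 g) →
            ∀ (μ : Measure (adelicGroupData (↥(maximalRealSubfield L)) L (IsCMField.complexConj L) 3 H).automorphicQuotient)
              [(adelicGroupData (↥(maximalRealSubfield L)) L (IsCMField.complexConj L) 3 H).IsAutomorphicMeasure μ]
              (W : Type) [AddCommGroup W] [Module ℂ W]
              (σ : Representation ℂ (finAdelic (↥(maximalRealSubfield L)) L (IsCMField.complexConj L) 3 H) W),
              σ.IsIrreducible → σ.IsSmooth → σ.IsAdmissible →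
              ∀ P : DiscreteAutomorphicRep (adelicGroupData (↥(maximalRealSubfield L)) L (IsCMField.complexConj L) 3 H) μ,
                (P.IsHolCotangentAt (cmArchSection L ι H T hT) (cmCompactFactor L ι H T hT) ∨
                  P.IsAntiholCotangentAt (cmArchSection L ι H T hT) (cmCompactFactor L ι H T hT)) →
                P.HasFinComponent σ →
                ∃ (μ : Literature.NumberTheory.Automorphic.IdeleClassGroup L →ₜ* Circle) (hμ : IsConjugateSymplectic L μ), HasWeight L μ 1 ∧
                  ∃ (a : (↥(maximalRealSubfield L))ˣ) (χ : Chi (↥(maximalRealSubfield L)) L (IsCMField.complexConj L)),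
                    ∀ (v : HeightOneSpectrum (𝓞 ↥(maximalRealSubfield L))) (Tv : Type) [AddCommGroup Tv] [Module ℂ Tv]
                      (τ : Representation ℂ (localPi L (IsCMField.complexConj L) 3 H v) Tv),
                      (τ.IsIrreducible ∧
                        isotypicComponent (MonoidAlgebra ℂ (localPi L (IsCMField.complexConj L) 3 H v))
                          (Representation.asModule (σ.comp (inclPlace (↥(maximalRealSubfield L)) L (IsCMField.complexConj L) 3 H v)))
                          (Representation.asModule τ) = ⊤) →
                      (τ.IsIrreducible ∧
                        isotypicComponent (MonoidAlgebra ℂ (localPi L (IsCMField.complexConj L) 3 H v))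
                          (Representation.asModule
                            ((rhoAtLine (↥(maximalRealSubfield L)) L (IsCMField.complexConj L) 3 e₁ (Matrix.diagonal dV)
                        (complexConj_imagUnit L) (imagUnit_ne_zero L) (imagUnit_mul_self L) (realDiagonal_isSymm L dV hdV)
                        (isUnit_det_realDiagonal L dV hdV hdV0) (realDiagonal_map L dV hdV).symm
                        (fun a => isCompatible_chiSplittingLine L e₁ dV hdV hdV0 (toHeckeCharacter L μ)
                          (isUnitary_toHeckeCharacter L μ) ((isOscillatorChar_toHeckeCharacter_iff μ).mpr hμ)
                          (TW (↥(maximalRealSubfield L)) a) (isSymm_TW (↥(maximalRealSubfield L)) a)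
                          (isUnit_det_TW (↥(maximalRealSubfield L)) a) (JW (↥(maximalRealSubfield L)) L a)
                          (JW_eq (↥(maximalRealSubfield L)) L a)) ιV a χ).comp
                              (inclPlace (↥(maximalRealSubfield L)) L (IsCMField.complexConj L) 3 H v)))
                          (Representation.asModule τ) = ⊤) := by
  refine F0P2cStubCEOfLocalThetaTypes.stubCE_of_localThetaTypes ?_
  intro L _ _ _ ι H T hT hdef h2 n' e₁ dV hdV hdV0 g hg ιV hιV μA _ W _ _ σ hirr hsm hadm P hP hfin
  obtain ⟨μ, hμ, hw, χ, ε, a₀, hcof, hloc⟩ :=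
    hPK L ι H T hT hdef h2 e₁ dV hdV hdV0 g hg ιV hιV μA W σ hirr hsm hadm P hP hfin
  obtain ⟨a, ha⟩ := hGL L ε a₀ hcof
  refine ⟨μ, hμ, hw, a, χ, fun v => ?_⟩
  obtain ⟨x, hx⟩ := hLW L (ε v) a v (ha v).symm
  -- LT at the general `e₁` = LR ∘ LTpu ∘ LR (the sub-line's `lt_of_LR_LTpu`)
  obtain ⟨E₁⟩ := hLR L e₁ (Equiv.prodUnique (Fin 3) (Fin 1)) dV hdV hdV0 μ hμ (ε v) χ v
  obtain ⟨E⟩ := hLTpu L dV hdV hdV0 μ hμ (ε v) a χ v x hx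
  obtain ⟨E₂⟩ := hLR L (Equiv.prodUnique (Fin 3) (Fin 1)) e₁ dV hdV hdV0 μ hμ a χ v
  exact (isotypicComponent_comp_congr_of_equiv (E₁.trans (E.trans E₂)) _ _).symm.trans (hloc v)

end Summit.HodgeConjecture.HodgeConjecture.Cruxes.H413.F0P2eCEOfRung2

end
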